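import Summits.AtomisticToContinuum.Crystallization.Theses.PalmUnimodularRigidity
import Summits.AtomisticToContinuum.Crystallization.Theorems.MinimiserShells.Negative.LoadBearing
import Summits.AtomisticToContinuum.Crystallization.Theorems.MinimiserShells.Negative.Rootedness
import Literature.Probability.Process.PointStationaryLaw
import Literature.MathematicalPhysics.StatisticalMechanics.RootEnergy
import Literature.MathematicalPhysics.StatisticalMechanics.MuGSC

/-!
# Shell counting with decay and Lennard-Jones tails over separated point sets of `ℝ³`

Helper file for stub `stub_equilibriumInLaw` (S1) of line `equilibrium-in-law-surgery`, crux
`MinimiserShells` (stmt-AtomisticToContinuum-9225): the two analytic error bounds of the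
cluster-repair argument (blueprint lemmas 2–3).

* `sum_inv_pow_six_le_of_far` — if the points of a finite `t ⊆ ℝ³` are pairwise `≥ δ` apart and
  all at distance `≥ ρ ≥ δ` from `p`, then `∑_{z ∈ t} |p − z|⁻⁶ ≤ 1000 δ⁻⁴ ρ⁻²` (shells
  `⌊|p − z|/δ⌋ = b ≥ ⌊ρ/δ⌋` hold `≤ (2b+3)³ ≤ 125 b³` points, `∑_{b ≥ b₀} b⁻³ ≤ 2 b₀⁻²`; the tree's
  `sum_inv_pow_six_le_of_le_dist` is the case without decay, `250 η⁻⁶`).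
* `abs_lennardJones_le_mul_inv_pow_six` — `|V_LJ(t)| ≤ (δ⁻⁶/12 + 1/6) t⁻⁶` on `[δ, ∞)`.
* `sum_abs_lennardJones_le_of_far` / `tsum_abs_lennardJones_le_of_far` — the Lennard-Jones
  field of a `δ`-separated set beyond distance `ρ ≥ max 1 δ` is at most `250 δ⁻⁴ ρ⁻²` in
  absolute value (finite and `tsum` forms).
* `sum_abs_lennardJones_le_crude` / `tsum_abs_lennardJones_le_crude` — without decay: the whole
  field of a `δ`-separated set seen from one of its points is at most
  `Bδ = 250 δ⁻⁶ (δ⁻⁶/12 + 1/6)` in absolute value (so `|h| ≤ Bδ/2` for hard-core roots).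
-/

noncomputable section

open MeasureTheory
open scoped ENNReal BigOperators

namespace Summit.AtomisticToContinuum.Crystallization.Theorems.PalmUnimodularRigidityMinimiserShells.EquilibriumInLaw.Shells

open Literature.Probability.Process (IsPointStationaryLaw IsRootedHardCore count_restrict_singleton_ne_zero_iff
  map_sub_count_restrict)
open Literature.MathematicalPhysics.StatisticalMechanics (lennardJones IsMuGSC UniformlyDiscrete)
open Summit.AtomisticToContinuum.Crystallization.Theses.PalmUnimodularRigidity (MinimiserShells UnimodularEnergyLowerBound)
open Summit.AtomisticToContinuum.Crystallization.Theorems.MinimiserShells.Negative.LoadBearing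
  (eStar meanRootEnergy GoodShell minimiserShells_iff)
open Literature.MathematicalPhysics.StatisticalMechanics (card_le_of_separated_of_dist_le
  sum_inv_pow_six_le_of_le_dist abs_lennardJones_le lennardJones_zero)
open Summit.AtomisticToContinuum.Crystallization.Theorems.MinimiserShells.Negative.Rootedness (E3)

/-! ## Shell counting with decay -/

/-- **Shell sum with decay.** If the points of the finite set `t ⊆ ℝ³` are pairwise `≥ δ > 0`
apart and all at distance `≥ ρ ≥ δ` from `p`, then `∑_{z ∈ t} |p − z|⁻⁶ ≤ 1000 δ⁻⁴ ρ⁻²`: the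
shell `⌊|p − z|/δ⌋ = b` (`b ≥ b₀ = ⌊ρ/δ⌋ ≥ 1`) holds at most `(2b+3)³ ≤ 125 b³` points (packing),
each contributing `≤ (bδ)⁻⁶`, and `∑_{b ≥ b₀} b⁻³ ≤ b₀⁻¹ ∑_{b ≥ b₀} b⁻² ≤ 2 b₀⁻²`, `ρ/δ ≤ 2 b₀`. -/
theorem sum_inv_pow_six_le_of_far (t : Finset E3) (p : E3) {δ ρ : ℝ} (hδ : 0 < δ) (hδρ : δ ≤ ρ)
    (hp : ∀ z ∈ t, ρ ≤ dist p z) (ht : ∀ z ∈ t, ∀ w ∈ t, z ≠ w → δ ≤ dist z w) :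
    ∑ z ∈ t, (dist p z)⁻¹ ^ 6 ≤ 1000 * δ⁻¹ ^ 4 * ρ⁻¹ ^ 2 := by
  classical
  set m : E3 → ℕ := fun z => ⌊dist p z / δ⌋₊ with hm
  set b₀ : ℕ := ⌊ρ / δ⌋₊ with hb₀
  have hρ : 0 < ρ := hδ.trans_le hδρ
  have hx1 : 1 ≤ ρ / δ := (one_le_div hδ).2 hδρ
  have hb₀1 : 1 ≤ b₀ := (Nat.one_le_floor_iff _).2 hx1
  have hb₀1' : (1 : ℝ) ≤ b₀ := by exact_mod_cast hb₀1
  have hb₀x : ρ / δ ≤ 2 * b₀ := by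
    have h1 := Nat.lt_floor_add_one (ρ / δ)
    linarith
  have hmb : ∀ z ∈ t, b₀ ≤ m z := fun z hz =>
    Nat.floor_mono (div_le_div_of_nonneg_right (hp z hz) hδ.le)
  have hm1 : ∀ z ∈ t, 1 ≤ m z := fun z hz => hb₀1.trans (hmb z hz)
  have hmle : ∀ z ∈ t, δ * m z ≤ dist p z := fun z hz => by
    have := Nat.floor_le (div_nonneg dist_nonneg hδ.le : 0 ≤ dist p z / δ)
    rwa [le_div_iff₀ hδ, mul_comm] at this
  have hmlt : ∀ z ∈ t, dist p z < (m z + 1) * δ := fun z hz => by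
    have := Nat.lt_floor_add_one (dist p z / δ)
    rwa [div_lt_iff₀ hδ] at this
  set s := t.image m with hs_def
  have hmem : ∀ z ∈ t, m z ∈ s := fun z hz => Finset.mem_image_of_mem m hz
  -- termwise
  have step1 : ∑ z ∈ t, (dist p z)⁻¹ ^ 6 ≤ ∑ z ∈ t, δ⁻¹ ^ 6 * ((m z : ℝ))⁻¹ ^ 6 := by
    refine Finset.sum_le_sum fun z hz => ?_
    rw [← mul_pow, ← mul_inv]
    have h0 : 0 < δ * m z := mul_pos hδ (by exact_mod_cast hm1 z hz)
    exact pow_le_pow_left₀ (inv_nonneg.2 dist_nonneg) (inv_anti₀ h0 (hmle z hz)) _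
  -- regroup by shells
  have step2 : ∑ z ∈ t, δ⁻¹ ^ 6 * ((m z : ℝ))⁻¹ ^ 6 =
      ∑ b ∈ s, ((t.filter fun z => m z = b).card : ℝ) * (δ⁻¹ ^ 6 * ((b : ℝ))⁻¹ ^ 6) := by
    have := Finset.sum_fiberwise_of_maps_to' hmem (fun b : ℕ => δ⁻¹ ^ 6 * ((b : ℝ))⁻¹ ^ 6)
    simp only [Finset.sum_const, nsmul_eq_mul] at this
    exact this.symm
  -- each shell holds at most `(2b+3)³` points
  have step3 : ∀ b ∈ s, ((t.filter fun z => m z = b).card : ℝ) ≤ (2 * (b : ℝ) + 3) ^ 3 := by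
    intro b _
    set F := t.filter fun z => m z = b with hF
    have hR : (0 : ℝ) ≤ ((b : ℝ) + 1) * δ := by positivity
    have := card_le_of_separated_of_dist_le F p hδ hR ?_ ?_
    · rw [finrank_euclideanSpace_fin] at this
      convert this using 2
      field_simp
      ring
    · intro c hc
      obtain ⟨hct, hcb⟩ := Finset.mem_filter.1 hc
      rw [dist_comm]
      have := hmlt c hct
      rw [hcb] at this
      exact this.le
    · intro c hc c' hc' hne
      exact ht c (Finset.mem_filter.1 hc).1 c' (Finset.mem_filter.1 hc').1 hne
  -- numerics per shell: `(2b+3)³ b⁻⁶ ≤ 125 b₀⁻¹ b⁻²` for `b ≥ b₀ ≥ 1`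
  have step4 : ∀ b ∈ s, (2 * (b : ℝ) + 3) ^ 3 * (δ⁻¹ ^ 6 * ((b : ℝ))⁻¹ ^ 6) ≤
      125 * δ⁻¹ ^ 6 * (b₀ : ℝ)⁻¹ * ((b : ℝ) ^ 2)⁻¹ := by
    intro b hb
    obtain ⟨z, hz, rfl⟩ := Finset.mem_image.1 hb
    have hb1 : (b₀ : ℝ) ≤ (m z : ℝ) := by exact_mod_cast hmb z hz
    set β : ℝ := (m z : ℝ)
    have hβ1 : 1 ≤ β := hb₀1'.trans hb1
    have hβ : 0 < β := by linarith
    have hr6 : 0 < δ⁻¹ ^ 6 := by positivity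
    have key : (2 * β + 3) ^ 3 * (β⁻¹) ^ 6 ≤ 125 * (b₀ : ℝ)⁻¹ * (β ^ 2)⁻¹ := by
      rw [inv_pow, mul_assoc, ← mul_inv, ← div_eq_mul_inv, ← div_eq_mul_inv,
        div_le_div_iff₀ (by positivity) (by positivity)]
      have h5 : (2 * β + 3) ^ 3 ≤ (5 * β) ^ 3 :=
        pow_le_pow_left₀ (by positivity) (by linarith) 3
      have h6 : (b₀ : ℝ) * β ^ 5 ≤ β ^ 6 := by
        calc (b₀ : ℝ) * β ^ 5 ≤ β * β ^ 5 := by gcongr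
          _ = β ^ 6 := by ring
      nlinarith [mul_le_mul_of_nonneg_right h5 (by positivity : (0 : ℝ) ≤ b₀ * β ^ 2)]
    calc (2 * β + 3) ^ 3 * (δ⁻¹ ^ 6 * (β⁻¹) ^ 6) = δ⁻¹ ^ 6 * ((2 * β + 3) ^ 3 * (β⁻¹) ^ 6) := by
          ring
      _ ≤ δ⁻¹ ^ 6 * (125 * (b₀ : ℝ)⁻¹ * (β ^ 2)⁻¹) := mul_le_mul_of_nonneg_left key hr6.le
      _ = 125 * δ⁻¹ ^ 6 * (b₀ : ℝ)⁻¹ * (β ^ 2)⁻¹ := by ring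
  -- `∑_{b ∈ s} b⁻² ≤ 2 / b₀`
  have step5 : ∑ b ∈ s, ((b : ℝ) ^ 2)⁻¹ ≤ 2 / b₀ := by
    have hsub : s ⊆ Finset.Ioo (b₀ - 1) (s.sup id + 1) := fun b hb => by
      rw [Finset.mem_Ioo]
      obtain ⟨z, hz, rfl⟩ := Finset.mem_image.1 hb
      exact ⟨by have := hmb z hz; omega, Nat.lt_succ_of_le (Finset.le_sup (f := id) hb)⟩
    have h2 := sum_Ioo_inv_sq_le (α := ℝ) (b₀ - 1) (s.sup id + 1)
    have hcast : ((b₀ - 1 : ℕ) : ℝ) + 1 = b₀ := by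
      rw [Nat.cast_sub hb₀1]
      push_cast
      ring
    rw [hcast] at h2
    calc ∑ b ∈ s, ((b : ℝ) ^ 2)⁻¹ ≤ ∑ b ∈ Finset.Ioo (b₀ - 1) (s.sup id + 1), ((b : ℝ) ^ 2)⁻¹ :=
          Finset.sum_le_sum_of_subset_of_nonneg hsub fun b _ _ => by positivity
      _ ≤ 2 / b₀ := h2
  have hr6 : 0 ≤ δ⁻¹ ^ 6 := by positivity
  have hb₀pos : (0 : ℝ) < b₀ := by linarith
  calc ∑ z ∈ t, (dist p z)⁻¹ ^ 6
      ≤ ∑ b ∈ s, ((t.filter fun z => m z = b).card : ℝ) * (δ⁻¹ ^ 6 * ((b : ℝ))⁻¹ ^ 6) :=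
        step1.trans_eq step2
    _ ≤ ∑ b ∈ s, (2 * (b : ℝ) + 3) ^ 3 * (δ⁻¹ ^ 6 * ((b : ℝ))⁻¹ ^ 6) :=
        Finset.sum_le_sum fun b hb => mul_le_mul_of_nonneg_right (step3 b hb) (by positivity)
    _ ≤ ∑ b ∈ s, 125 * δ⁻¹ ^ 6 * (b₀ : ℝ)⁻¹ * ((b : ℝ) ^ 2)⁻¹ := Finset.sum_le_sum step4
    _ = 125 * δ⁻¹ ^ 6 * (b₀ : ℝ)⁻¹ * ∑ b ∈ s, ((b : ℝ) ^ 2)⁻¹ := by rw [Finset.mul_sum]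
    _ ≤ 125 * δ⁻¹ ^ 6 * (b₀ : ℝ)⁻¹ * (2 / b₀) :=
        mul_le_mul_of_nonneg_left step5 (by positivity)
    _ = 250 * δ⁻¹ ^ 6 * ((b₀ : ℝ)⁻¹) ^ 2 := by rw [div_eq_mul_inv]; ring
    _ ≤ 250 * δ⁻¹ ^ 6 * (2 * δ * ρ⁻¹) ^ 2 := by
        gcongr
        -- `b₀⁻¹ ≤ 2 δ ρ⁻¹` since `ρ/δ ≤ 2 b₀`
        rw [inv_le_iff_one_le_mul₀ hb₀pos]
        have : ρ ≤ 2 * b₀ * δ := by rwa [div_le_iff₀ hδ] at hb₀x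
        calc (1 : ℝ) = ρ * ρ⁻¹ := (mul_inv_cancel₀ hρ.ne').symm
          _ ≤ 2 * b₀ * δ * ρ⁻¹ := by gcongr
          _ = 2 * δ * ρ⁻¹ * b₀ := by ring
    _ = 1000 * δ⁻¹ ^ 4 * ρ⁻¹ ^ 2 := by
        have hδ0 : δ ≠ 0 := hδ.ne'
        field_simp
        ring

/-! ## Lennard-Jones tails -/

/-- `|V_LJ(t)| ≤ (δ⁻⁶/12 + 1/6) t⁻⁶` for `t ≥ δ > 0` (`t⁻¹² = t⁻⁶ t⁻⁶ ≤ δ⁻⁶ t⁻⁶`). -/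
theorem abs_lennardJones_le_mul_inv_pow_six {δ t : ℝ} (hδ : 0 < δ) (ht : δ ≤ t) :
    |lennardJones t| ≤ (δ⁻¹ ^ 6 / 12 + 1 / 6) * t⁻¹ ^ 6 := by
  have h0 : 0 ≤ t⁻¹ := inv_nonneg.2 (hδ.le.trans ht)
  have h1 : t⁻¹ ≤ δ⁻¹ := inv_anti₀ hδ ht
  have h6 : t⁻¹ ^ 6 ≤ δ⁻¹ ^ 6 := pow_le_pow_left₀ h0 h1 6
  have h6' : 0 ≤ t⁻¹ ^ 6 := pow_nonneg h0 6
  have h12 : t⁻¹ ^ 12 = t⁻¹ ^ 6 * t⁻¹ ^ 6 := by ring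
  unfold lennardJones
  rw [h12, abs_le]
  constructor <;> nlinarith [mul_le_mul_of_nonneg_right h6 h6', mul_nonneg h6' h6']

/-- **Tail of the field, finite form.** If the points of `t` are pairwise `≥ δ` apart and all at
distance `≥ ρ ≥ max 1 δ` from `p`, then `∑_{z ∈ t} |V_LJ(|p − z|)| ≤ 250 δ⁻⁴ ρ⁻²`. -/
theorem sum_abs_lennardJones_le_of_far (t : Finset E3) (p : E3) {δ ρ : ℝ} (hδ : 0 < δ)
    (hρ : max 1 δ ≤ ρ) (hp : ∀ z ∈ t, ρ ≤ dist p z)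
    (ht : ∀ z ∈ t, ∀ w ∈ t, z ≠ w → δ ≤ dist z w) :
    ∑ z ∈ t, |lennardJones (dist p z)| ≤ 250 * δ⁻¹ ^ 4 * ρ⁻¹ ^ 2 := by
  have h1 : (1 : ℝ) ≤ ρ := (le_max_left _ _).trans hρ
  have hδρ : δ ≤ ρ := (le_max_right _ _).trans hρ
  calc ∑ z ∈ t, |lennardJones (dist p z)| ≤ ∑ z ∈ t, 1 / 4 * (dist p z)⁻¹ ^ 6 :=
        Finset.sum_le_sum fun z hz => abs_lennardJones_le (h1.trans (hp z hz))
    _ = 1 / 4 * ∑ z ∈ t, (dist p z)⁻¹ ^ 6 := (Finset.mul_sum _ _ _).symm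
    _ ≤ 1 / 4 * (1000 * δ⁻¹ ^ 4 * ρ⁻¹ ^ 2) :=
        mul_le_mul_of_nonneg_left (sum_inv_pow_six_le_of_far t p hδ hδρ hp ht) (by norm_num)
    _ = 250 * δ⁻¹ ^ 4 * ρ⁻¹ ^ 2 := by ring

/-- **Crude bound, finite form.** If the points of `t` are pairwise `≥ δ` apart and all at
distance `≥ δ` from `p` unless equal to `p`, then `∑_{z ∈ t} |V_LJ(|p − z|)| ≤ Bδ`,
`Bδ := 250 δ⁻⁶ (δ⁻⁶/12 + 1/6)` (the term `z = p` vanishes, `V_LJ(0) = 0`). -/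
theorem sum_abs_lennardJones_le_crude (t : Finset E3) (p : E3) {δ : ℝ} (hδ : 0 < δ)
    (hp : ∀ z ∈ t, z ≠ p → δ ≤ dist p z) (ht : ∀ z ∈ t, ∀ w ∈ t, z ≠ w → δ ≤ dist z w) :
    ∑ z ∈ t, |lennardJones (dist p z)| ≤ 250 * δ⁻¹ ^ 6 * (δ⁻¹ ^ 6 / 12 + 1 / 6) := by
  classical
  -- remove the centre if present
  have hsplit : ∑ z ∈ t, |lennardJones (dist p z)| = ∑ z ∈ t.erase p, |lennardJones (dist p z)| := by
    by_cases hpt : p ∈ t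
    · rw [← Finset.add_sum_erase t _ hpt, dist_self, lennardJones_zero, abs_zero, zero_add]
    · rw [Finset.erase_eq_of_notMem hpt]
  rw [hsplit]
  set t' := t.erase p with ht'
  have hp' : ∀ z ∈ t', δ ≤ dist p z := fun z hz =>
    hp z (Finset.mem_of_mem_erase hz) (Finset.ne_of_mem_erase hz)
  have ht'' : ∀ z ∈ t', ∀ w ∈ t', z ≠ w → δ ≤ dist z w := fun z hz w hw hzw =>
    ht z (Finset.mem_of_mem_erase hz) w (Finset.mem_of_mem_erase hw) hzw
  calc ∑ z ∈ t', |lennardJones (dist p z)| ≤ ∑ z ∈ t', (δ⁻¹ ^ 6 / 12 + 1 / 6) * (dist p z)⁻¹ ^ 6 :=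
        Finset.sum_le_sum fun z hz => abs_lennardJones_le_mul_inv_pow_six hδ (hp' z hz)
    _ = (δ⁻¹ ^ 6 / 12 + 1 / 6) * ∑ z ∈ t', (dist p z)⁻¹ ^ 6 := (Finset.mul_sum _ _ _).symm
    _ ≤ (δ⁻¹ ^ 6 / 12 + 1 / 6) * (250 * δ⁻¹ ^ 6) :=
        mul_le_mul_of_nonneg_left (sum_inv_pow_six_le_of_le_dist t' p hδ hp' ht'') (by positivity)
    _ = 250 * δ⁻¹ ^ 6 * (δ⁻¹ ^ 6 / 12 + 1 / 6) := by ring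

/-- From uniform bounds on finite partial sums of `|f|` to summability and a `tsum` bound. -/
theorem summable_and_tsum_abs_le_of_sum_le {ι : Type*} {f : ι → ℝ} {c : ℝ}
    (h : ∀ u : Finset ι, ∑ i ∈ u, |f i| ≤ c) :
    Summable f ∧ |∑' i, f i| ≤ c := by
  have habs : Summable fun i => |f i| :=
    summable_of_sum_le (fun i => abs_nonneg (f i)) h
  have hs : Summable f := habs.of_abs
  have hnorm : Summable fun i => ‖f i‖ := by simpa only [Real.norm_eq_abs] using habs
  refine ⟨hs, ?_⟩
  calc |∑' i, f i| ≤ ∑' i, |f i| := by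
        have := norm_tsum_le_tsum_norm hnorm
        simpa only [Real.norm_eq_abs] using this
    _ ≤ c := habs.tsum_le_of_sum_le h

/-- **Tail of the field, `tsum` form.** For `T ⊆ ℝ³` with pairwise distances `≥ δ > 0` and all
points at distance `≥ ρ ≥ max 1 δ` from `p`: the field `z ↦ V_LJ(|p − z|)` is summable over `T`
and `|∑_{z ∈ T} V_LJ(|p − z|)| ≤ 250 δ⁻⁴ ρ⁻²`. -/
theorem tsum_abs_lennardJones_le_of_far {T : Set E3} (p : E3) {δ ρ : ℝ} (hδ : 0 < δ)
    (hρ : max 1 δ ≤ ρ) (hp : ∀ z ∈ T, ρ ≤ dist p z)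
    (hT : ∀ z ∈ T, ∀ w ∈ T, z ≠ w → δ ≤ dist z w) :
    Summable (fun z : T => lennardJones (dist p z)) ∧
      |∑' z : T, lennardJones (dist p z)| ≤ 250 * δ⁻¹ ^ 4 * ρ⁻¹ ^ 2 := by
  classical
  refine summable_and_tsum_abs_le_of_sum_le fun u => ?_
  have := sum_abs_lennardJones_le_of_far (u.image Subtype.val) p hδ hρ
    (fun z hz => by
      obtain ⟨y, -, rfl⟩ := Finset.mem_image.1 hz
      exact hp y y.2)
    (fun z hz w hw hzw => by
      obtain ⟨y, -, rfl⟩ := Finset.mem_image.1 hz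
      obtain ⟨y', -, rfl⟩ := Finset.mem_image.1 hw
      exact hT y y.2 y' y'.2 hzw)
  rwa [Finset.sum_image fun a _ b _ h => Subtype.val_injective h] at this

/-- **Crude bound, `tsum` form.** For `T ⊆ ℝ³` with pairwise distances `≥ δ > 0` and all points
`≠ p` at distance `≥ δ` from `p`: the field `z ↦ V_LJ(|p − z|)` is summable over `T` and
`|∑_{z ∈ T} V_LJ(|p − z|)| ≤ Bδ = 250 δ⁻⁶ (δ⁻⁶/12 + 1/6)`. -/
theorem tsum_abs_lennardJones_le_crude {T : Set E3} (p : E3) {δ : ℝ} (hδ : 0 < δ)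
    (hp : ∀ z ∈ T, z ≠ p → δ ≤ dist p z) (hT : ∀ z ∈ T, ∀ w ∈ T, z ≠ w → δ ≤ dist z w) :
    Summable (fun z : T => lennardJones (dist p z)) ∧
      |∑' z : T, lennardJones (dist p z)| ≤ 250 * δ⁻¹ ^ 6 * (δ⁻¹ ^ 6 / 12 + 1 / 6) := by
  classical
  refine summable_and_tsum_abs_le_of_sum_le fun u => ?_
  have := sum_abs_lennardJones_le_crude (u.image Subtype.val) p hδ
    (fun z hz hzp => by
      obtain ⟨y, -, rfl⟩ := Finset.mem_image.1 hz
      exact hp y y.2 hzp)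
    (fun z hz w hw hzw => by
      obtain ⟨y, -, rfl⟩ := Finset.mem_image.1 hz
      obtain ⟨y', -, rfl⟩ := Finset.mem_image.1 hw
      exact hT y y.2 y' y'.2 hzw)
  rwa [Finset.sum_image fun a _ b _ h => Subtype.val_injective h] at this

/-- Registered stub marker (helper part 2/14 of `stub_equilibriumInLaw`, line `equilibrium-in-law-surgery`):
the shell sum with decay `sum_inv_pow_six_le_of_far`, closed form. -/
theorem stub_equilibriumInLaw_part02 :
    ∀ (t : Finset (EuclideanSpace ℝ (Fin 3))) (p : EuclideanSpace ℝ (Fin 3)) (δ ρ : ℝ), 0 < δ → δ ≤ ρ →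
      (∀ z ∈ t, ρ ≤ dist p z) → (∀ z ∈ t, ∀ w ∈ t, z ≠ w → δ ≤ dist z w) →
      ∑ z ∈ t, (dist p z)⁻¹ ^ 6 ≤ 1000 * δ⁻¹ ^ 4 * ρ⁻¹ ^ 2 :=
  fun t p _ _ hδ hδρ hp ht => sum_inv_pow_six_le_of_far t p hδ hδρ hp ht

end Summit.AtomisticToContinuum.Crystallization.Theorems.PalmUnimodularRigidityMinimiserShells.EquilibriumInLaw.Shells

end
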